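import Mathlib
import Summits.Ventures.DiscreteObjects.Mahler.CensusAuxiliaryLog

/-!
# The annulus hypothesis (H_log) from its two boundary circles (venture `DiscreteObjects`, target L)

Cell `pub-namedobj`, seat `pub-namedobj-mahler-g15`. Framing: lottery ticket; floor = certified bounds/negative
ranges.

The auxiliary function `F(z) = Re h(z) - Σ_j e_j log ‖q̂_j(z)‖` (`h(z) = Σ_k a_k (z^k + z^{-k})/2`, `q̂_j(z) = Q_j(z)Q_j(z⁻¹)`,
`F = auxF a qs` of `CensusAuxiliaryCuts`) is superharmonic on `ℂ ∖ {0}` (harmonic off the zeros of the `q̂_j`, `+∞` at them),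
and `-m₀ - c log ‖z‖` is harmonic; hence the annulus hypothesis (H_log) = `AuxBoundLog a qs B m₀ c` of `CensusAuxiliaryLog`
follows from the two boundary inequalities

* `F(z) ≥ -m₀` on `‖z‖ = 1` and
* `F(z) ≥ -m₀ - c log B` on `‖z‖ = B`

(`auxBoundLog_of_circles`).  We prove this with Mathlib's maximum-modulus principle
(`Complex.norm_le_of_forall_mem_frontier_norm_le`) applied on the open annulus `1 < ‖z‖ < B` to the holomorphic function

  `f(z) = exp(-N h(z)) · ∏_j q̂_j(z)^{n_j} · z^{-κ}`,   `‖f(z)‖ = exp(-N F(z) - κ log ‖z‖)`,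

where `e_j = n_j/N` and `c = κ/N` (`N, n_j, κ ∈ ℕ`; the weights of a certificate are rational, so this is no restriction).
Consequence for the kernel census: certifying an explicit-auxiliary-function cut needs two ONE-dimensional checks (in the
variable `w = 2 cos θ`, file `CensusAuxCirclePoly`) instead of a two-dimensional one.
-/

namespace Summit.Ventures.DiscreteObjects.Mahler

open Polynomial

/-! ## The holomorphic data -/

/-- `h(z) = Σ_{k<|a|} (a_k/2) (z^{k+1} + z^{-(k+1)})`, the analytic function with `Re h =` the cosine part of `auxF`. -/
noncomputable def auxH (a : List ℤ) (z : ℂ) : ℂ :=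
  ∑ k ∈ Finset.range a.length, ((((a.getD k 0 : ℤ) : ℝ) / 2 : ℝ) : ℂ) * (z ^ (k + 1) + z⁻¹ ^ (k + 1))

/-- `Re h(z)` is the cosine part of `auxF`. -/
theorem auxH_re (a : List ℤ) (z : ℂ) :
    (auxH a z).re = ∑ k ∈ Finset.range a.length, ((a.getD k 0 : ℤ) : ℝ) * ((z ^ (k + 1) + z⁻¹ ^ (k + 1)).re / 2) := by
  unfold auxH
  rw [Complex.re_sum]
  apply Finset.sum_congr rfl
  intro k _
  rw [Complex.re_ofReal_mul]
  ring

/-- `auxF = Re h - Σ_j e_j log ‖q̂_j‖`. -/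
theorem auxF_eq_auxH_re (a : List ℤ) (qs : List (List ℤ × ℚ)) (z : ℂ) :
    auxF a qs z = (auxH a z).re -
      ∑ j ∈ Finset.range qs.length, (((qs.getD j ([], 0)).2 : ℚ) : ℝ) * Real.log ‖qhat (qs.getD j ([], 0)).1 z‖ := by
  rw [auxH_re]; rfl

/-- `V_v` is an entire function. -/
theorem differentiable_vEval (v : List ℝ) : Differentiable ℂ (vEval v) := by
  induction v with
  | nil => exact differentiable_const (0 : ℂ)
  | cons b w ih =>
    show Differentiable ℂ (fun ω => ((b : ℝ) : ℂ) + ω * vEval w ω)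
    exact (differentiable_const _).add (differentiable_id.mul ih)

/-- `q̂_v` is holomorphic off the origin. -/
theorem differentiableOn_qhat (v : List ℤ) : DifferentiableOn ℂ (qhat v) {z : ℂ | z ≠ 0} := by
  have h1 := (differentiable_vEval (v.map (Int.cast : ℤ → ℝ))).differentiableOn (s := {z : ℂ | z ≠ 0})
  have h2 : DifferentiableOn ℂ (fun z : ℂ => vEval (v.map (Int.cast : ℤ → ℝ)) z⁻¹) {z : ℂ | z ≠ 0} :=
    (differentiable_vEval _).comp_differentiableOn differentiableOn_inv
  exact h1.mul h2

/-- `h` is holomorphic off the origin. -/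
theorem differentiableOn_auxH (a : List ℤ) : DifferentiableOn ℂ (auxH a) {z : ℂ | z ≠ 0} := by
  unfold auxH
  apply DifferentiableOn.fun_sum
  intro k _
  apply DifferentiableOn.const_mul
  exact (differentiableOn_id.pow _).add (differentiableOn_inv.pow _)

/-- The comparison function `f(z) = exp(-N h(z)) · ∏_j q̂_j(z)^{n_j} · (z⁻¹)^κ`. -/
noncomputable def auxPhi (a : List ℤ) (qs : List (List ℤ × ℚ)) (N : ℕ) (n : ℕ → ℕ) (κ : ℕ) (z : ℂ) : ℂ :=
  Complex.exp (-(((N : ℝ) : ℂ) * auxH a z)) *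
    (∏ j ∈ Finset.range qs.length, qhat (qs.getD j ([], 0)).1 z ^ n j) * z⁻¹ ^ κ

/-- `f` is holomorphic off the origin. -/
theorem differentiableOn_auxPhi (a : List ℤ) (qs : List (List ℤ × ℚ)) (N : ℕ) (n : ℕ → ℕ) (κ : ℕ) :
    DifferentiableOn ℂ (auxPhi a qs N n κ) {z : ℂ | z ≠ 0} := by
  unfold auxPhi
  refine DifferentiableOn.mul (DifferentiableOn.mul ?_ ?_) (differentiableOn_inv.pow _)
  · exact ((differentiableOn_auxH a).const_mul _).neg.cexp
  · apply DifferentiableOn.fun_finsetProd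
    intro j _
    exact (differentiableOn_qhat _).pow _

/-- `‖f(z)‖ = exp(-N Re h(z)) · ∏ ‖q̂_j(z)‖^{n_j} · ‖z‖^{-κ}`. -/
theorem norm_auxPhi (a : List ℤ) (qs : List (List ℤ × ℚ)) (N : ℕ) (n : ℕ → ℕ) (κ : ℕ) (z : ℂ) :
    ‖auxPhi a qs N n κ z‖ = Real.exp (-((N : ℝ) * (auxH a z).re)) *
      (∏ j ∈ Finset.range qs.length, ‖qhat (qs.getD j ([], 0)).1 z‖ ^ n j) * ‖z‖⁻¹ ^ κ := by
  unfold auxPhi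
  rw [norm_mul, norm_mul, Complex.norm_exp, norm_prod, norm_pow, norm_inv]
  congr 2
  · rw [Complex.neg_re, Complex.re_ofReal_mul]
  · apply Finset.prod_congr rfl; intro j _; rw [norm_pow]

/-- Off the zeros: `log ‖f(z)‖ = -N·F(z) - κ log ‖z‖` when `e_j = n_j / N`. -/
theorem log_norm_auxPhi (a : List ℤ) (qs : List (List ℤ × ℚ)) {N : ℕ} (hN : 0 < N) (n : ℕ → ℕ) (κ : ℕ)
    (hn : ∀ j < qs.length, (((qs.getD j ([], 0)).2 : ℚ) : ℝ) = (n j : ℝ) / N) {z : ℂ} (hz : z ≠ 0)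
    (hq : ∀ j < qs.length, qhat (qs.getD j ([], 0)).1 z ≠ 0) :
    Real.log ‖auxPhi a qs N n κ z‖ = -(N : ℝ) * auxF a qs z - κ * Real.log ‖z‖ := by
  have hr : 0 < ‖z‖ := norm_pos_iff.mpr hz
  have hprod_pos : 0 < ∏ j ∈ Finset.range qs.length, ‖qhat (qs.getD j ([], 0)).1 z‖ ^ n j := by
    apply Finset.prod_pos
    intro j hj
    rw [Finset.mem_range] at hj
    exact pow_pos (norm_pos_iff.mpr (hq j hj)) _
  rw [norm_auxPhi, Real.log_mul (mul_pos (Real.exp_pos _) hprod_pos).ne' (pow_pos (inv_pos.mpr hr) _).ne',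
    Real.log_mul (Real.exp_pos _).ne' hprod_pos.ne', Real.log_exp, Real.log_pow, Real.log_inv,
    Real.log_prod (hf := fun j hj => by
      rw [Finset.mem_range] at hj; exact (pow_pos (norm_pos_iff.mpr (hq j hj)) _).ne')]
  simp only [Real.log_pow]
  have hN' : (N : ℝ) ≠ 0 := by exact_mod_cast hN.ne'
  rw [auxF_eq_auxH_re]
  have hsum : ∑ j ∈ Finset.range qs.length, (((qs.getD j ([], 0)).2 : ℚ) : ℝ) * Real.log ‖qhat (qs.getD j ([], 0)).1 z‖ =
      (∑ j ∈ Finset.range qs.length, (n j : ℝ) * Real.log ‖qhat (qs.getD j ([], 0)).1 z‖) / N := by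
    rw [Finset.sum_div]
    apply Finset.sum_congr rfl
    intro j hj
    rw [Finset.mem_range] at hj
    rw [hn j hj]
    field_simp
  rw [hsum]
  field_simp
  ring

/-! ## The open annulus -/

/-- The open annulus `1 < ‖z‖ < B`. -/
def openAnnulus (B : ℝ) : Set ℂ := {z : ℂ | 1 < ‖z‖ ∧ ‖z‖ < B}

/-- It is open. -/
theorem isOpen_openAnnulus (B : ℝ) : IsOpen (openAnnulus B) :=
  (isOpen_lt continuous_const continuous_norm).inter (isOpen_lt continuous_norm continuous_const)

/-- It is bounded. -/
theorem isBounded_openAnnulus (B : ℝ) : Bornology.IsBounded (openAnnulus B) := by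
  refine (Metric.isBounded_closedBall (x := (0 : ℂ)) (r := B)).subset ?_
  intro z hz
  rw [Metric.mem_closedBall, dist_zero_right]
  exact hz.2.le

/-- Its closure lies in the closed annulus. -/
theorem closure_openAnnulus_subset (B : ℝ) : closure (openAnnulus B) ⊆ {z : ℂ | 1 ≤ ‖z‖ ∧ ‖z‖ ≤ B} := by
  apply closure_minimal
  · intro z hz; exact ⟨hz.1.le, hz.2.le⟩
  · exact (isClosed_le continuous_const continuous_norm).inter (isClosed_le continuous_norm continuous_const)

/-- Its frontier lies in the two circles. -/
theorem frontier_openAnnulus_subset (B : ℝ) {z : ℂ} (hz : z ∈ frontier (openAnnulus B)) : ‖z‖ = 1 ∨ ‖z‖ = B := by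
  rw [(isOpen_openAnnulus B).frontier_eq] at hz
  obtain ⟨hcl, hnot⟩ := hz
  have h1 := closure_openAnnulus_subset B hcl
  simp only [openAnnulus, Set.mem_setOf_eq, not_and, not_lt] at hnot
  rcases h1.1.eq_or_lt with h | h
  · exact Or.inl h.symm
  · exact Or.inr (le_antisymm h1.2 (hnot h))

/-! ## From the circles to the annulus -/

/-- **(H_log) from the two boundary circles.**  If `e_j = n_j/N` (`N ≥ 1`) and `c = κ/N`, and the auxiliary function
satisfies `F ≥ -m₀` on `‖z‖ = 1` and `F ≥ -m₀ - c log B` on `‖z‖ = B` (off the zeros of the `q̂_j`), then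
`F(z) ≥ -m₀ - c log ‖z‖` on the whole annulus `1 ≤ ‖z‖ ≤ B` (off the zeros). -/
theorem auxBoundLog_of_circles (a : List ℤ) (qs : List (List ℤ × ℚ)) {B m₀ : ℝ} {N : ℕ} (hN : 0 < N) (n : ℕ → ℕ)
    (hn : ∀ j < qs.length, (((qs.getD j ([], 0)).2 : ℚ) : ℝ) = (n j : ℝ) / N) (hn0 : ∀ j < qs.length, 0 < n j) (κ : ℕ)
    (h1 : ∀ z : ℂ, ‖z‖ = 1 → (∀ j < qs.length, qhat (qs.getD j ([], 0)).1 z ≠ 0) → -m₀ ≤ auxF a qs z)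
    (hB : ∀ z : ℂ, ‖z‖ = B → (∀ j < qs.length, qhat (qs.getD j ([], 0)).1 z ≠ 0) →
      -m₀ - (κ : ℝ) / N * Real.log B ≤ auxF a qs z) :
    AuxBoundLog a qs B m₀ ((κ : ℝ) / N) := by
  intro z hz1 hzB hq
  have hz : z ≠ 0 := by rintro rfl; norm_num at hz1
  have hNr : (0 : ℝ) < N := by exact_mod_cast hN
  -- boundary cases
  rcases hz1.eq_or_lt with h | hlt1
  · have := h1 z h.symm hq; rw [← h, Real.log_one, mul_zero, sub_zero]; exact this
  rcases hzB.lt_or_eq with hltB | h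
  swap
  · rw [h]; exact hB z h hq
  -- interior: maximum modulus for `auxPhi` on the open annulus
  set f := auxPhi a qs N n κ with hf
  set C := Real.exp ((N : ℝ) * m₀) with hC
  have hbound : ∀ w : ℂ, (‖w‖ = 1 ∨ ‖w‖ = B) → ‖f w‖ ≤ C := by
    intro w hw
    have hw0 : w ≠ 0 := by
      intro hw0
      rw [hw0, norm_zero] at hw
      rcases hw with h | h
      · norm_num at h
      · linarith
    by_cases hqw : ∀ j < qs.length, qhat (qs.getD j ([], 0)).1 w ≠ 0
    · have hfw : f w ≠ 0 := by
        rw [hf]; unfold auxPhi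
        refine mul_ne_zero (mul_ne_zero (Complex.exp_ne_zero _) ?_) (pow_ne_zero _ (inv_ne_zero hw0))
        rw [Finset.prod_ne_zero_iff]
        intro j hj
        rw [Finset.mem_range] at hj
        exact pow_ne_zero _ (hqw j hj)
      have hlog := log_norm_auxPhi a qs hN n κ hn hw0 hqw
      rw [← Real.exp_log (norm_pos_iff.mpr hfw), hC, Real.exp_le_exp, hlog]
      rcases hw with hw | hw
      · have := h1 w hw hqw
        rw [hw, Real.log_one, mul_zero, sub_zero]
        nlinarith
      · have := hB w hw hqw
        rw [hw]
        have hkey : -m₀ * N - (κ : ℝ) * Real.log B ≤ auxF a qs w * N := by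
          have := mul_le_mul_of_nonneg_right this hNr.le
          have hsimp : (-m₀ - (κ : ℝ) / N * Real.log B) * N = -m₀ * N - (κ : ℝ) * Real.log B := by
            field_simp
          linarith [hsimp]
        nlinarith
    · -- some `q̂_j(w) = 0`: then `f w = 0`
      push Not at hqw
      obtain ⟨j, hj, hj0⟩ := hqw
      have hzero : f w = 0 := by
        rw [hf]; unfold auxPhi
        have : (∏ j ∈ Finset.range qs.length, qhat (qs.getD j ([], 0)).1 w ^ n j) = 0 :=
          Finset.prod_eq_zero (Finset.mem_range.mpr hj) (by rw [hj0]; exact zero_pow (hn0 j hj).ne')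
        rw [this, mul_zero, zero_mul]
      rw [hzero, norm_zero, hC]; exact (Real.exp_pos _).le
  have hd : DiffContOnCl ℂ f (openAnnulus B) := by
    apply DifferentiableOn.diffContOnCl
    refine (differentiableOn_auxPhi a qs N n κ).mono ?_
    intro w hw h0
    have := closure_openAnnulus_subset B hw
    rw [Set.mem_setOf_eq] at this
    rw [h0, norm_zero] at this
    linarith [this.1]
  have hle : ‖f z‖ ≤ C :=
    Complex.norm_le_of_forall_mem_frontier_norm_le (isBounded_openAnnulus B) hd
      (fun w hw => hbound w (frontier_openAnnulus_subset B hw)) (subset_closure ⟨hlt1, hltB⟩)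
  have hfz : f z ≠ 0 := by
    rw [hf]; unfold auxPhi
    refine mul_ne_zero (mul_ne_zero (Complex.exp_ne_zero _) ?_) (pow_ne_zero _ (inv_ne_zero hz))
    rw [Finset.prod_ne_zero_iff]
    intro j hj
    rw [Finset.mem_range] at hj
    exact pow_ne_zero _ (hq j hj)
  have hlogle : Real.log ‖f z‖ ≤ (N : ℝ) * m₀ := by
    rw [← Real.exp_le_exp, Real.exp_log (norm_pos_iff.mpr hfz)]; exact hle
  rw [log_norm_auxPhi a qs hN n κ hn hz hq] at hlogle
  have key : (-m₀ - (κ : ℝ) / N * Real.log ‖z‖) * N ≤ auxF a qs z * N := by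
    have hsimp : (-m₀ - (κ : ℝ) / N * Real.log ‖z‖) * N = -m₀ * N - (κ : ℝ) * Real.log ‖z‖ := by
      field_simp
    rw [hsimp]
    nlinarith
  exact le_of_mul_le_mul_right key hNr

end Summit.Ventures.DiscreteObjects.Mahler
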